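import Summits.Ventures.PercRepro.SixFourResidueFourPlaneLineXbarA

/-!
# PercRepro — C-025 at `(6,4)`: the plane-line branch (γ) at `t = 4`, part 2B — Lemma X̄′ without a plane cap
(p5, gen 10; lead (nn))

**`Xcnt_le_planeLine`**: for a plane-line normalisation `D : PLData M G` of a rank-`4` set with every plane trace
of `≤ g − 3` points and `g ≥ 10`,

  `X ≤ 2·(Σ_{C ∈ classes} 2^{|C|} + 2·n·#classes + 2·n) + 2·2^{n+e}·[two classes cover ρ]`

(`n = |L|`, `e = |ℓ ∩ ρ| ∈ {0, 1}`) — mine-2's Lemma X̄′ (§21.18.4 (a)) with the crude covering count of Lemma TW.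

Proof.  A set `Z` counted by `X` has, with `G ∖ Z`, two of the `n ≥ 3` points of `L` on one side; complementation
exchanges the two one-sided families (`card_X₂'_eq`), so `X = 2·#X₁′ + #X₁₂` (`card_Xset_eq`).  A one-sided `Z` is
`L ∪ S` with `S ⊆ C` for a class `C` (`famA`), or `(L ∖ {x}) ∪ (C ∖ W)` with `W` inside the trace of `C` on the line
`cl(ρ ∖ C)` (`famC`, `|W| ≤ 1`), or `(L ∖ {x}) ∪ (subset of ℓ ∩ ρ)` (`famD`) — `X₁'_subset`.  A two-sided `Z` determines
a covering ordered pair `(C_A, C_B)` of classes and is `(Z ∩ L) ∪ (ρ ∖ C_B) ∪ (Z ∩ C_A ∩ C_B)` (`famB`, `X₁₂_subset`).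
The counts are in `SixFourResidueFourPlaneLineXbarC.lean`.
-/

namespace PercRepro.SixFour

open Finset ThmH

variable {α : Type*} [DecidableEq α] {M : Matroid α} [M.Finite] {G : Finset α}

namespace PLData

variable (D : PLData M G)

/-! ## The families -/
/-- The one-sided sets: two points of `L`, at most one point of `L` in the complement. -/
noncomputable def X₁' : Finset (Finset α) :=
  (Xset M G).filter fun Z => 2 ≤ (Z ∩ D.L).card ∧ ((G \ Z) ∩ D.L).card ≤ 1

/-- The other one-sided sets. -/
noncomputable def X₂' : Finset (Finset α) :=
  (Xset M G).filter fun Z => (Z ∩ D.L).card ≤ 1 ∧ 2 ≤ ((G \ Z) ∩ D.L).card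

/-- The two-sided sets: two points of `L` on both sides. -/
noncomputable def X₁₂ : Finset (Finset α) :=
  (Xset M G).filter fun Z => 2 ≤ (Z ∩ D.L).card ∧ 2 ≤ ((G \ Z) ∩ D.L).card

/-- `famA`: `L ∪ S` with `S` inside a class. -/
noncomputable def famA : Finset (Finset α) :=
  D.classes.biUnion fun C => C.powerset.image fun S => D.L ∪ S

/-- The trace of a class on the line spanned by its complement (empty unless that complement has rank `≤ 2`). -/
noncomputable def lamC (C : Finset α) : Finset α :=
  if M.eRk ((D.ρ \ C : Finset α) : Set α) ≤ 2 then C ∩ clF M (D.ρ \ C) else ∅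

/-- `famC`: `(L ∖ {x}) ∪ (C ∖ W)` with `W ⊆ lamC C`. -/
noncomputable def famC : Finset (Finset α) :=
  D.classes.biUnion fun C => D.L.biUnion fun x => (D.lamC C).powerset.image fun W => D.L.erase x ∪ (C \ W)

/-- `famD`: `(L ∖ {x}) ∪ T` with `T ⊆ ℓ ∩ ρ`. -/
noncomputable def famD : Finset (Finset α) :=
  D.L.biUnion fun x => (D.ellF ∩ D.ρ).powerset.image fun T => D.L.erase x ∪ T

/-- The covering ordered pairs of classes. -/
noncomputable def coverPairs : Finset (Finset α × Finset α) :=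
  (D.classes ×ˢ D.classes).filter fun q => q.1 ≠ q.2 ∧ D.ρ ⊆ q.1 ∪ q.2

/-- `famB`: the two-sided sets of a covering pair. -/
noncomputable def famB : Finset (Finset α) :=
  D.coverPairs.biUnion fun q =>
    (D.L.powerset ×ˢ (q.1 ∩ q.2).powerset).image fun r => r.1 ∪ (D.ρ \ q.2) ∪ r.2

variable {D}

omit [DecidableEq α] in
/-- A set lies in its `clF`. -/
theorem subset_clF' {B : Finset α} (hB : B ⊆ gr M) : B ⊆ clF M B := by
  intro z hz
  rw [← Finset.mem_coe, coe_clF]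
  exact M.subset_closure _ (by rw [← coe_gr]; exact_mod_cast hB) (Finset.mem_coe.2 hz)

/-! ## The decomposition `X = 2·#X₁′ + #X₁₂` -/

/-- For `Z ⊆ G`, `(G ∖ Z) ∩ L = L ∖ Z`. -/
theorem sdiff_inter_L (Z : Finset α) : (G \ Z) ∩ D.L = D.L \ Z := by
  ext z
  simp only [Finset.mem_inter, Finset.mem_sdiff]
  constructor
  · rintro ⟨⟨-, hz⟩, hzL⟩
    exact ⟨hzL, hz⟩
  · rintro ⟨hzL, hz⟩
    exact ⟨⟨D.L_subset hzL, hz⟩, hzL⟩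

/-- The two sides of a subset of `G` split `L`. -/
theorem card_inter_L_add (Z : Finset α) : (Z ∩ D.L).card + ((G \ Z) ∩ D.L).card = D.L.card := by
  rw [sdiff_inter_L, Finset.inter_comm, Finset.card_inter_add_card_sdiff]

/-- `X = #X₁′ + #X₁₂ + #X₂′` when `|L| ≥ 3`. -/
theorem card_Xset_eq (h3 : 3 ≤ D.L.card) : Xcnt M G = D.X₁'.card + D.X₁₂.card + D.X₂'.card := by
  rw [Xcnt_eq_card_Xset]
  have e1 := Finset.card_filter_add_card_filter_not (s := Xset M G)
    (p := fun Z : Finset α => 2 ≤ (Z ∩ D.L).card)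
  have e2 := Finset.card_filter_add_card_filter_not
    (s := (Xset M G).filter fun Z : Finset α => 2 ≤ (Z ∩ D.L).card)
    (p := fun Z : Finset α => ((G \ Z) ∩ D.L).card ≤ 1)
  rw [Finset.filter_filter, Finset.filter_filter] at e2
  have h1 : D.X₁' = (Xset M G).filter fun Z : Finset α => 2 ≤ (Z ∩ D.L).card ∧ ((G \ Z) ∩ D.L).card ≤ 1 := rfl
  have h12 : D.X₁₂ = (Xset M G).filter fun Z : Finset α => 2 ≤ (Z ∩ D.L).card ∧ ¬ ((G \ Z) ∩ D.L).card ≤ 1 := by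
    unfold X₁₂
    refine Finset.filter_congr fun Z _ => ?_
    constructor
    · rintro ⟨h, h'⟩; exact ⟨h, by omega⟩
    · rintro ⟨h, h'⟩; exact ⟨h, by omega⟩
  have h2 : D.X₂' = (Xset M G).filter fun Z : Finset α => ¬ 2 ≤ (Z ∩ D.L).card := by
    unfold X₂'
    refine Finset.filter_congr fun Z _ => ?_
    have := card_inter_L_add (D := D) Z
    constructor
    · rintro ⟨h, -⟩; omega
    · intro h; exact ⟨by omega, by omega⟩
  rw [h1, h12, h2]
  omega

/-- Complementation identifies `X₂′` with `X₁′`. -/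
theorem card_X₂'_eq : D.X₂'.card = D.X₁'.card := by
  refine Finset.card_bij (fun Z _ => G \ Z) ?_ ?_ ?_
  · intro Z hZ
    unfold X₂' at hZ
    unfold X₁'
    rw [Finset.mem_filter] at hZ ⊢
    obtain ⟨hZX, h1, h2⟩ := hZ
    have hZG := (mem_Xset.1 hZX).1
    refine ⟨sdiff_mem_Xset hZX, ?_, ?_⟩
    · exact h2
    · rw [Finset.sdiff_sdiff_eq_self hZG]
      exact h1
  · intro Z hZ Z' hZ' h
    have hZG := (mem_Xset.1 (Finset.mem_filter.1 hZ).1).1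
    have hZ'G := (mem_Xset.1 (Finset.mem_filter.1 hZ').1).1
    have := congrArg (fun W => G \ W) h
    simp only [Finset.sdiff_sdiff_eq_self hZG, Finset.sdiff_sdiff_eq_self hZ'G] at this
    exact this
  · intro Z hZ
    unfold X₁' at hZ
    rw [Finset.mem_filter] at hZ
    obtain ⟨hZX, h1, h2⟩ := hZ
    have hZG := (mem_Xset.1 hZX).1
    refine ⟨G \ Z, ?_, Finset.sdiff_sdiff_eq_self hZG⟩
    unfold X₂'
    rw [Finset.mem_filter, Finset.sdiff_sdiff_eq_self hZG]
    exact ⟨sdiff_mem_Xset hZX, h2, h1⟩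

/-! ## The one-sided sets -/

/-- A set counted by `X` with two points of `L` on both sides has rank `3`. -/
theorem eRk_eq_three_of_two_two (hs : Simple M) (hG : G ⊆ gr M) (hr : M.eRk (G : Set α) = 4)
    {Z : Finset α} (hZ : Z ∈ Xset M G) (h2 : 2 ≤ (Z ∩ D.L).card) (h2' : 2 ≤ ((G \ Z) ∩ D.L).card) :
    M.eRk (Z : Set α) = 3 := by
  obtain ⟨hZG, hr1, -⟩ := mem_Xset.1 hZ
  obtain ⟨k, hk, -⟩ := eRk_eq_nat M Z
  have hk3 : k ≤ 3 := by rw [hk] at hr1; exact_mod_cast hr1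
  rcases Nat.lt_or_ge k 3 with hlt | hge
  · exfalso
    have hle2 : M.eRk (Z : Set α) ≤ 2 := by rw [hk]; exact_mod_cast (by omega : k ≤ 2)
    have hZℓ := subset_ellF_of_two_mem_of_eRk_le_two hs hG hZG h2 hle2
    -- `G ⊆ cl(G ∖ Z)`: `ℓ` is spanned by two points of `L` in `G ∖ Z`, the rest of `G` lies in `G ∖ Z`
    have hℓ := ellF_subset_clF_of_two_mem (D := D) hs hG h2'
    have hsub : G ⊆ clF M (G \ Z) := by
      intro z hz
      by_cases hzZ : z ∈ Z
      · exact hℓ (hZℓ hzZ)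
      · exact subset_clF' (Finset.sdiff_subset.trans hG) (Finset.mem_sdiff.2 ⟨hz, hzZ⟩)
    have := M.eRk_mono (Finset.coe_subset.2 hsub)
    rw [hr, coe_clF, M.eRk_closure_eq] at this
    have h4 : (4 : ℕ∞) ≤ 3 := this.trans (mem_Xset.1 hZ).2.2
    exact absurd h4 (by decide)
  · rw [hk]; exact_mod_cast (by omega : k = 3)

/-- **The two-sided sets lie in `famB`.** -/
theorem X₁₂_subset (hs : Simple M) (hG : G ⊆ gr M) (hr : M.eRk (G : Set α) = 4) : D.X₁₂ ⊆ D.famB := by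
  intro Z hZ
  unfold X₁₂ at hZ
  rw [Finset.mem_filter] at hZ
  obtain ⟨hZX, h2, h2'⟩ := hZ
  have hZG := (mem_Xset.1 hZX).1
  have hZ3 := eRk_eq_three_of_two_two hs hG hr hZX h2 h2'
  have hZc3 : M.eRk ((G \ Z : Finset α) : Set α) = 3 :=
    eRk_eq_three_of_two_two (D := D) hs hG hr (sdiff_mem_Xset hZX) h2'
      (by rw [Finset.sdiff_sdiff_eq_self hZG]; exact h2)
  obtain ⟨CA, hCA, hZA⟩ := exists_class_of_two_mem_of_eRk_eq_three hs hG hZG h2 hZ3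
  obtain ⟨CB, hCB, hZB⟩ := exists_class_of_two_mem_of_eRk_eq_three hs hG Finset.sdiff_subset h2' hZc3
  have hL2 : 2 ≤ D.L.card := by
    have := Finset.card_le_card (Finset.inter_subset_right : Z ∩ D.L ⊆ D.L); omega
  -- the two classes differ
  have hne : CA ≠ CB := by
    rintro rfl
    have hGsub : G ⊆ D.PiC CA := by
      intro z hz
      have hsub := (PiC_facts hs hG hL2 hCA).2.2
      by_cases hzZ : z ∈ Z
      · exact hsub (hZA hzZ)
      · exact hsub (hZB (Finset.mem_sdiff.2 ⟨hz, hzZ⟩))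
    have := M.eRk_mono (Finset.coe_subset.2 hGsub)
    rw [hr, (mem_planes.1 (PiC_facts hs hG hL2 hCA).1).2.2] at this
    exact absurd this (by decide)
  -- they cover `ρ`
  have hcov : D.ρ ⊆ CA ∪ CB := by
    intro z hz
    have hzG : z ∈ G := D.ρ_subset hz
    have hzL : z ∉ D.L := by
      unfold L; rw [Finset.mem_sdiff]; exact fun h => h.2 (Finset.mem_inter.1 hz).1
    by_cases hzZ : z ∈ Z
    · rcases Finset.mem_union.1 (hZA hzZ) with h | h
      · exact (hzL h).elim
      · exact Finset.mem_union_left _ h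
    · rcases Finset.mem_union.1 (hZB (Finset.mem_sdiff.2 ⟨hzG, hzZ⟩)) with h | h
      · exact (hzL h).elim
      · exact Finset.mem_union_right _ h
  unfold famB
  rw [Finset.mem_biUnion]
  refine ⟨(CA, CB), ?_, ?_⟩
  · unfold coverPairs
    rw [Finset.mem_filter, Finset.mem_product]
    exact ⟨⟨hCA, hCB⟩, hne, hcov⟩
  · rw [Finset.mem_image]
    refine ⟨(Z ∩ D.L, Z ∩ (CA ∩ CB)), ?_, ?_⟩
    · rw [Finset.mem_product, Finset.mem_powerset, Finset.mem_powerset]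
      exact ⟨Finset.inter_subset_right, Finset.inter_subset_right⟩
    · -- `Z = (Z ∩ L) ∪ (ρ ∖ C_B) ∪ (Z ∩ C_A ∩ C_B)`
      ext z
      symm
      simp only [Finset.mem_union, Finset.mem_inter, Finset.mem_sdiff]
      constructor
      · intro hz
        by_cases hzL : z ∈ D.L
        · exact Or.inl (Or.inl ⟨hz, hzL⟩)
        · have hzρ : z ∈ D.ρ := by
            have := hZG hz
            rw [← D.ρ_union_L, Finset.mem_union] at this
            exact this.resolve_right hzL
          have hzA : z ∈ CA := (Finset.mem_union.1 (hZA hz)).resolve_left hzL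
          by_cases hzB : z ∈ CB
          · exact Or.inr ⟨hz, hzA, hzB⟩
          · exact Or.inl (Or.inr ⟨hzρ, hzB⟩)
      · rintro ((⟨hz, -⟩ | ⟨hzρ, hzB⟩) | ⟨hz, -⟩)
        · exact hz
        · by_contra hzZ
          have hzGZ : z ∈ G \ Z := Finset.mem_sdiff.2 ⟨D.ρ_subset hzρ, hzZ⟩
          rcases Finset.mem_union.1 (hZB hzGZ) with h | h
          · unfold L at h
            exact (Finset.mem_sdiff.1 h).2 (Finset.mem_inter.1 hzρ).1
          · exact hzB h
        · exact hz

/-- **The one-sided sets lie in `famA ∪ famC ∪ famD`.** -/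
theorem X₁'_subset (hs : Simple M) (hG : G ⊆ gr M) (hpl : ∀ P ∈ planes M, (P ∩ G).card + 3 ≤ G.card) :
    D.X₁' ⊆ D.famA ∪ D.famC ∪ D.famD := by
  intro Z hZ
  unfold X₁' at hZ
  rw [Finset.mem_filter] at hZ
  obtain ⟨hZX, h2, h1⟩ := hZ
  obtain ⟨hZG, hr1, hr2⟩ := mem_Xset.1 hZX
  have hL2 : 2 ≤ D.L.card := by
    have := Finset.card_le_card (Finset.inter_subset_right : Z ∩ D.L ⊆ D.L); omega
  have hsplitL := card_inter_L_add (D := D) Z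
  have hZρsub : Z \ D.L ⊆ D.ρ := by
    intro z hz
    rw [Finset.mem_sdiff] at hz
    have := hZG hz.1
    rw [← D.ρ_union_L, Finset.mem_union] at this
    exact this.resolve_right hz.2
  -- the two sub-cases on `|L ∖ Z|`
  have hcard : ((G \ Z) ∩ D.L).card = 0 ∨ ((G \ Z) ∩ D.L).card = 1 := by omega
  -- the `L ∖ Z = {x}` bookkeeping
  have hsingle : ((G \ Z) ∩ D.L).card = 1 → ∃ x ∈ D.L, x ∈ G \ Z ∧ Z ∩ D.L = D.L.erase x := by
    intro h1'
    obtain ⟨x, hx⟩ := Finset.card_eq_one.1 h1'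
    have hxmem : x ∈ (G \ Z) ∩ D.L := by rw [hx]; exact Finset.mem_singleton_self _
    rw [Finset.mem_inter] at hxmem
    refine ⟨x, hxmem.2, hxmem.1, ?_⟩
    ext z
    rw [Finset.mem_inter, Finset.mem_erase]
    constructor
    · rintro ⟨hz, hzL⟩
      refine ⟨?_, hzL⟩
      rintro rfl
      exact (Finset.mem_sdiff.1 hxmem.1).2 hz
    · rintro ⟨hzx, hzL⟩
      refine ⟨?_, hzL⟩
      by_contra hzZ
      have : z ∈ (G \ Z) ∩ D.L := Finset.mem_inter.2 ⟨Finset.mem_sdiff.2 ⟨D.L_subset hzL, hzZ⟩, hzL⟩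
      rw [hx, Finset.mem_singleton] at this
      exact hzx this
  -- the `L ⊆ Z` bookkeeping: membership in `famA` for `Z ∖ L ⊆ C`
  have hfamA : ((G \ Z) ∩ D.L).card = 0 → ∀ C ∈ D.classes, Z \ D.L ⊆ C → Z ∈ D.famA := by
    intro h0 C hC hsub
    have hLZ : D.L ⊆ Z := by
      intro z hz
      by_contra hzZ
      have : z ∈ (G \ Z) ∩ D.L := Finset.mem_inter.2 ⟨Finset.mem_sdiff.2 ⟨D.L_subset hz, hzZ⟩, hz⟩
      rw [Finset.card_eq_zero] at h0
      rw [h0] at this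
      exact Finset.notMem_empty _ this
    unfold famA
    rw [Finset.mem_biUnion]
    refine ⟨C, hC, ?_⟩
    rw [Finset.mem_image]
    exact ⟨Z \ D.L, Finset.mem_powerset.2 hsub, Finset.union_sdiff_of_subset hLZ⟩
  obtain ⟨k, hk, -⟩ := eRk_eq_nat M Z
  have hk3 : k ≤ 3 := by rw [hk] at hr1; exact_mod_cast hr1
  rcases Nat.lt_or_ge k 3 with hlt | hge
  · -- rank `≤ 2`: `Z ⊆ ℓ ∩ G = L ∪ (ℓ ∩ ρ)`
    have hle2 : M.eRk (Z : Set α) ≤ 2 := by rw [hk]; exact_mod_cast (by omega : k ≤ 2)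
    have hZℓ := subset_ellF_of_two_mem_of_eRk_le_two hs hG hZG h2 hle2
    have hZsub : Z \ D.L ⊆ D.ellF ∩ D.ρ := fun z hz =>
      Finset.mem_inter.2 ⟨hZℓ (Finset.mem_sdiff.1 hz).1, hZρsub hz⟩
    rcases hcard with h0 | h1'
    · obtain ⟨C₀, hC₀⟩ := classes_nonempty (D := D) hs hG hL2
      exact Finset.mem_union_left _ (Finset.mem_union_left _
        (hfamA h0 C₀ hC₀ (hZsub.trans (ellF_inter_ρ_subset_class hC₀))))
    · obtain ⟨x, hxL, -, hZL⟩ := hsingle h1'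
      refine Finset.mem_union_right _ ?_
      unfold famD
      rw [Finset.mem_biUnion]
      refine ⟨x, hxL, ?_⟩
      rw [Finset.mem_image]
      refine ⟨Z \ D.L, Finset.mem_powerset.2 hZsub, ?_⟩
      rw [← hZL, Finset.union_comm]
      exact Finset.sdiff_union_inter Z D.L
  · -- rank `3`: `Z ⊆ L ∪ C` for a class `C`
    have hZ3 : M.eRk (Z : Set α) = 3 := by rw [hk]; exact_mod_cast (by omega : k = 3)
    obtain ⟨C, hC, hZC⟩ := exists_class_of_two_mem_of_eRk_eq_three hs hG hZG h2 hZ3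
    have hZρC : Z \ D.L ⊆ C := by
      intro z hz
      rw [Finset.mem_sdiff] at hz
      exact (Finset.mem_union.1 (hZC hz.1)).resolve_left hz.2
    rcases hcard with h0 | h1'
    · exact Finset.mem_union_left _ (Finset.mem_union_left _ (hfamA h0 C hC hZρC))
    · obtain ⟨x, hxL, hxGZ, hZL⟩ := hsingle h1'
      -- `r(ρ ∖ Z) ≤ 2`: otherwise `x` over a rank-`3` part of `ρ` gives `r(G ∖ Z) = 4`
      have hρZG : D.ρ \ Z ⊆ G \ Z := fun z hz =>
        Finset.mem_sdiff.2 ⟨D.ρ_subset (Finset.mem_sdiff.1 hz).1, (Finset.mem_sdiff.1 hz).2⟩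
      have hρZ : M.eRk ((D.ρ \ Z : Finset α) : Set α) ≤ 2 := by
        by_contra hnot
        have hle3 : M.eRk ((D.ρ \ Z : Finset α) : Set α) ≤ 3 := by
          have := M.eRk_mono (Finset.coe_subset.2 (Finset.sdiff_subset : D.ρ \ Z ⊆ D.ρ))
          rwa [eRk_ρ (D := D)] at this
        have h3 : M.eRk ((D.ρ \ Z : Finset α) : Set α) = 3 := by
          obtain ⟨k', hk', -⟩ := eRk_eq_nat M (D.ρ \ Z)
          rw [hk'] at hnot hle3 ⊢
          have ha : k' ≤ 3 := by exact_mod_cast hle3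
          have hb : ¬ (k' : ℕ∞) ≤ 2 := hnot
          have hb' : 2 < k' := by
            by_contra hc
            exact hb (by exact_mod_cast (by omega : k' ≤ 2))
          exact_mod_cast (by omega : k' = 3)
        have h4 := eRk_eq_four_of_mem_L (D := D) hG (Finset.sdiff_subset : D.ρ \ Z ⊆ D.ρ) hρZG
          Finset.sdiff_subset h3 hxL hxGZ
        exact absurd (h4.trans hr2) (by decide)
      have hsub' : D.ρ \ C ⊆ D.ρ \ Z := by
        intro z hz
        rw [Finset.mem_sdiff] at hz ⊢
        refine ⟨hz.1, fun hzZ => hz.2 (hZρC (Finset.mem_sdiff.2 ⟨hzZ, ?_⟩))⟩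
        unfold L
        rw [Finset.mem_sdiff]
        exact fun h => h.2 (Finset.mem_inter.1 hz.1).1
      obtain ⟨hrC, hWcl⟩ := subset_clF_sdiff_of_eRk_le_two hs hG hL2 hpl hC
        (Finset.sdiff_subset : D.ρ \ Z ⊆ D.ρ) hsub' hρZ
      have hW₀ : C ∩ (D.ρ \ Z) ⊆ D.lamC C := by
        unfold lamC
        rw [if_pos hrC]
        intro z hz
        rw [Finset.mem_inter] at hz ⊢
        exact ⟨hz.1, hWcl hz.2⟩
      refine Finset.mem_union_left _ (Finset.mem_union_right _ ?_)
      unfold famC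
      rw [Finset.mem_biUnion]
      refine ⟨C, hC, ?_⟩
      rw [Finset.mem_biUnion]
      refine ⟨x, hxL, ?_⟩
      rw [Finset.mem_image]
      refine ⟨C ∩ (D.ρ \ Z), Finset.mem_powerset.2 hW₀, ?_⟩
      ext z
      symm
      rw [Finset.mem_union, Finset.mem_sdiff, Finset.mem_inter, Finset.mem_sdiff]
      constructor
      · intro hz
        by_cases hzL : z ∈ D.L
        · left
          rw [← hZL]
          exact Finset.mem_inter.2 ⟨hz, hzL⟩
        · right
          exact ⟨hZρC (Finset.mem_sdiff.2 ⟨hz, hzL⟩), fun h => h.2.2 hz⟩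
      · rintro (hz | ⟨hzC, hz⟩)
        · rw [← hZL] at hz
          exact (Finset.mem_inter.1 hz).1
        · by_contra hzZ
          exact hz ⟨hzC, (classes_facts hC hs hG hL2).1 hzC, hzZ⟩

end PLData

end PercRepro.SixFour
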